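import Literature.MathematicalPhysics.QuantumFieldTheory.Balaban1983to89.Node00.TorusCoverGaugeTokens152153BoxUniform
import Literature.MathematicalPhysics.QuantumFieldTheory.Balaban1983to89.Node00.DomainsMeet
import Summits.QuantumFields.YangMills.Theorems.BalabanUVNodesK0S5CollarNumerics
import HarnessLib

/-!
# N07 [B11] (= [15] = [Balaban1985Variational]) Sect. F, sub-target S3 — **THE (152)∕(153) `Within`-WITNESS DOOR KEYED ON THE V20-G GUARD, IN THE BINDER ORDER OF THE
# S6 HEAD's PER-DATUM TOKEN `DatumGaugeSplitTopStepCoreG … Mc ρ Adm …`** — generation 6's uniform door `gauge152_REfiner153_box_of_within_of_prop6P_uniform` with its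
# four per-datum side conditions DISCHARGED from the plan's guard `c ≤ ν.M₁ ∧ k + c₀ ≤ F.m + K`: the floor ⇒ the collar clause; the level guard ⇒ the non-wrapping of the
# collared print cube (k0-s1-w3's `injOn_cover_cube_propCubeP`, BY NAME) and `j ≤ m + K`; `a₀ ≤ a0OfP` ⇒ the radii ceiling; `M₀ := Mc`.  Plus the clause-6 MEET face.

Cell `pub-ymgap`, width seat `pub-ymgap-dag-n07-w3` generation 7 (sub-target S3 = (145)–(156) at objects), CLAIM-1 ∕ INTENT-1 (cell bus 2026-08-28).  `--kind proof
--supports stmt-QuantumFields-27364 --as helper` (K1⁹ `StabilityBRunRowsAtRecordR13SepCoPHV` per dag-lead KEY MAP v2; count-neutral; def-free).  [15] = [Balaban1985Variational];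
[6] = [Balaban1985RegularSpaces]; [B6] = [Balaban1984PropagatorsII]; [I] = [Balaban1987RG1].

THE POINT.  The S6 head's knit (`pub-ymgap-dag-n07-w4`, `S6-HEAD-RECIPE.md` § UPDATE g3 ∕ g3-final) proves the per-datum token
`N07LocalLettersCoreGuarded.DatumGaugeSplitTopStepCoreG F N Sup Mc ρ Adm B₃ C θ Q κ a₀ a₁` at `Sup := suppDomOfRecord` and the plan's V20-G guard
`Adm := fun ν _ _ K k _ => c ≤ ν.M₁ ∧ k + c₀ ≤ F.m + K`; per datum `(j, a)` with `1 ≤ j ≤ k` and a `Within 3`-witness `x ∈ cubeExt (side L Mc j) a 0`, `π y ∈ Ω_j(s)`, its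
FIRST step is S3: [6] Thm 2 ∕ Prop. 6 on the datum's collared print cube ⇒ ONE gauge `u`, ONE potential `A` with the (152) letters on the window `π '' box L (cornerP Mc ρ a) (sideP Mc ρ) j`
and the (153) rows.  Generation 6's door (`Node00.TorusCoverGaugeTokens152153BoxUniform`) supplies exactly that but DISPLAYS four side conditions the recipe lists as «to discharge
from the binders at knit time»: the floor `(11·4 + 4ρ + Mc + 3)·L ≤ ν.M₁`, the non-wrapping `Set.InjOn π (cube L (cornerP Mc ρ a) (sideP Mc ρ) ρ j 0)`, the level range
`j ≤ m + K`, and the radii ceiling `ε_m ≤ a0OfP F N Mc ρ B₁ c₁`.  THIS FILE discharges all four from the token's own binders: the floor half of the guard gives the first;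
the level half `k + c₀ ≤ F.m + K` gives `sitesPerDir j ≥ sitesPerDir k = 2L^{m+K−k} ≥ 2L^{c₀} ≥ Mc + 44 + 6ρ`, whence the non-wrapping by k0-s1-w3's
`K0S5CollarNumerics.injOn_cover_cube_propCubeP` (the projections of `propCubeP` are `rfl`) and `j ≤ m + K` (otherwise `sitesPerDir j = 2 < 44`); `a₀ ≤ a0OfP` threads the
ceiling.  The conclusion is generation 6's, letter for letter (clause 6 quantified over the proof of `j ≤ m + K`, which the caller no longer holds).  §3 adds the MEET face of
clause 6: at the boundary-datum family `D″ := cubeDomains ⊓ D♭` of recipe § UPDATE g3 ([15] (150) «Ω′_j = □_j ∩ Ω_j») the (153) rows hold for the SAME `A`, by dag-n07-e's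
`ker_QpE_le_of_domainsLe (domainsMeet_le_left _ _)` — one line, generic `P`.

WHAT IS PROVED (sorry-free; no definition; axioms standard).
* §1 `sitesPerDir` arithmetic (generic `P : Params`): `sitesPerDir_le_sitesPerDir_of_le` (antitone in the level, NO range hypothesis), `le_m_add_K_of_three_le_sitesPerDir`,
  `two_mul_pow_le_sitesPerDir_of_levelGuard` (`j ≤ k`, `k + c₀ ≤ m + K` ⇒ `2L^{c₀} ≤ sitesPerDir j`), `exists_le_two_mul_pow` (the knit's `c₀` exists); ★ `injOn_cover_cube_cornerP_of_le_sitesPerDir` (the head's FILE 2 binder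
  `Set.InjOn π (cube L (cornerP Mc ρ a) (sideP Mc ρ) ρ j 0)` from `Mc + 11d + 6ρ ≤ sitesPerDir k`, `j ≤ k`), ★ `injOn_cover_cube_cornerP_of_levelGuard` (from the level guard).
* §2 at NODE 00's four-tori: ★★★ `datumGauge152_REfiner153_of_prop6P_of_floor` (floor + `Mc + 44 + 6ρ ≤ sitesPerDir k` form), ★★★ `datumGauge152_REfiner153_of_prop6P_guarded`
  (the V20-G conjunction `c ≤ ν.M₁ ∧ k + c₀ ≤ F.m + K` with `(11·4 + 4ρ + Mc + 3)·L ≤ c`, `Mc + 44 + 6ρ ≤ 2L^{c₀}` stated once), ★ `…_guarded_of_dvd` ([6] Prop. 6 held at a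
  divisor `ρ₀ ∣ ρ` — stub 2′'s letters; `prop6Printed_zdCubP_anti`).
* §3 ★ `RE_zero_meet_left_of_finer` ∕ `RE_zero_meet_right_of_finer` (generic `P`: a clause quantified over all kernel-finer families holds at every meet with the cube family).
* §4 ★ `numerics_cornerP_of_levelGuard` (at NODE 00's tori: the head's FILE 2 geometry binders at the S3 datum — corner on the `F.L·M_h`-grid, `F.L·M_h ∣ sideP`,
  `F.L·M_h ∣ sitesPerDir j`, non-wrapping — from `F.L·M_h ∣ ρ`, `M_h = L^{a′}`, `a′ + 1 ≤ c₀`, the level guard and `Mc + 44 + 6ρ ≤ 2L^{c₀}`; k0-s1-w3's `numerics_propCubeP` re-keyed).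
HONEST SCOPE.  Count-neutral kernel-lane bookkeeping: binder threading + `sitesPerDir` arithmetic; generation 6's door, k0-s1-w3's non-wrapping lemma and dag-n07-e's refinement
lemma CONSUMED BY NAME, nothing restated; [6] Proposition 6 on print's class is the HYPOTHESIS `hP6` (N05's node ∕ stub 2′'s body), applied once per datum; NOTHING of
[15]∕[6]∕[B6] analysis asserted; `DatumGaugeSplitTopStepCoreG` ∕ `HalvingStepTop(Core)G` ∕ `Prop8RegSepTopStepG` ∕ `stub_prop8StepCoP13` ∕ K0⁷ ∕ K1⁹ NOT closed; N07 ∕ N05 NOT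
discharged; the cell's typed ∕ discharged counts are not moved by this file (the chair's tally is the only count); one finite 𝕋⁴ programme at fixed ε — R4 closes the
conditional finite-𝕋⁴ rung `BalabanLadder.UV` ONLY; the YM mass gap (Clay) is NOT proved by any of this; nothing continuum ∕ ℝ⁴ ∕ infinite volume ∕ OS.  No `sorry`, no
`def`, no `instance`, no `notation`.

RELATED IN THE TREE, NOT DUPLICATED: generation 6 `Node00/TorusCoverGaugeTokens152153BoxUniform` (the door — CONSUMED), generation 5 `…BoxFiner` ∕ `Node00/TorusCoverLandau153REFiner`
(the finer sixth clause), k0-s1-w3 `Thm/BalabanUVNodesK0S5CollarNumerics` §3 (non-wrapping at the print datum — CONSUMED), dag-n07-e `Node00/DomainsMeet` ∕ `…Refinement`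
(CONSUMED), dag-n07-e `Node00/TorusCoverGaugeTokensGuarded` (the guard-generic (9)-TOKENS `Gauge9RegSepTopStepG` — token level, K1∕K0a side; this file is the families-level
per-datum door the S6 head calls), dag-n07-w4 `Thm/…N07LocalLettersCoreGuarded` (the guarded S6 tokens — the consumer).

References: T. Bałaban, CMP **102** (1985) 277–309 [Balaban1985Variational] (144) p.300, (150)–(153) p.301, p.304 lines 1–2; CMP **99** (1985) 75–102 [Balaban1985RegularSpaces]
Prop. 6 (1.135)–(1.138) p.99, p.98; CMP **96** (1984) 223–250 [Balaban1984PropagatorsII] (2.1) p.224, (2.10)–(2.12) p.225; CMP **109** (1987) 249–301 [Balaban1987RG1] (0.1) p.251.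
-/

set_option autoImplicit false

noncomputable section

namespace Summit.QuantumFields.YangMills.BalabanUVNodes.N07DatumGauge152Guarded

open scoped Matrix.Norms.L2Operator InnerProductSpace RealInnerProductSpace
open Literature.MathematicalPhysics.QuantumFieldTheory.Balaban1983to89
open Literature.MathematicalPhysics.QuantumFieldTheory.Balaban1983to89.Node00
open Literature.MathematicalPhysics.QuantumFieldTheory.Balaban1983to89.B12RegularSpaces111 (gaugeU expI grad)
open Literature.MathematicalPhysics.QuantumFieldTheory.Balaban1983to89.B15DeterminingSets
open T4Continuum (T4Family)
open B15Eq112TorusCover (cover)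
open B14DomainGeom (Pt Within)
open B14.Eq213MaximalDomains (side cubeExt)
open B8Eq131Cubes (box cube)
open B8LeafModelZd (ZdIdx)
open B6SectADomainsV1 (Domains)
open B6SectAOperatorsV1 (RE dsE QpE ScalarSpace)
open Literature.MathematicalPhysics.QuantumFieldTheory.BalabanImbrieJaffe1984to88.BIJ85AxialPropagator411 (BondSpace)
open Summit.QuantumFields.YangMills.Theorems.K0S5CollarNumerics (injOn_cover_cube_propCubeP)

/-! ## §1  `sitesPerDir` arithmetic and the non-wrapping of the collared print cube from the level guard -/

section Arithmetic

variable {P : Params}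

/-- **`sitesPerDir` IS ANTITONE IN THE LEVEL** (`2L^{m+K−j}`, truncated subtraction): finer levels have more sites per direction; NO range hypothesis.
[cite: Balaban1987RG1, (0.1) p.251 (bookkeeping)] -/
theorem sitesPerDir_le_sitesPerDir_of_le {j k : ℕ} (hjk : j ≤ k) : P.sitesPerDir k ≤ P.sitesPerDir j := by
  unfold Params.sitesPerDir
  exact Nat.mul_le_mul_left 2 (Nat.pow_le_pow_right P.L_pos (by omega))

/-- **A LEVEL WITH AT LEAST THREE SITES PER DIRECTION IS IN RANGE** `k ≤ m + K` (above the range `sitesPerDir k = 2·L⁰ = 2`).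
[cite: Balaban1987RG1, (0.1) p.251 (bookkeeping)] -/
theorem le_m_add_K_of_three_le_sitesPerDir {k : ℕ} (h : 3 ≤ P.sitesPerDir k) : k ≤ P.m + P.K := by
  by_contra hk
  unfold Params.sitesPerDir at h
  rw [show P.m + P.K - k = 0 by omega, pow_zero] at h
  omega

/-- **THE LEVEL GUARD BOUNDS THE PERIOD FROM BELOW**: `j ≤ k`, `k + c₀ ≤ m + K` ⇒ `2·L^{c₀} ≤ sitesPerDir j = 2L^{m+K−j}`.
[cite: Balaban1987RG1, (0.1) p.251 (bookkeeping)] -/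
theorem two_mul_pow_le_sitesPerDir_of_levelGuard {j k c₀ : ℕ} (hjk : j ≤ k) (hlev : k + c₀ ≤ P.m + P.K) : 2 * P.L ^ c₀ ≤ P.sitesPerDir j := by
  refine le_trans ?_ (sitesPerDir_le_sitesPerDir_of_le hjk)
  unfold Params.sitesPerDir
  exact Nat.mul_le_mul_left 2 (Nat.pow_le_pow_right P.L_pos (by omega))

/-- **THE LEVEL-GUARD EXPONENT EXISTS**: for every bound `X` there is `c₀` with `X ≤ 2·L^{c₀}` (`c₀ := X`: `X < 2^X ≤ L^X ≤ 2·L^X`, `L ≥ 2`) — the knit's choice of `c₀`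
after `ρ` and `Mc` (`X := Mc + 44 + 6ρ`). [cite: Balaban1987RG1, (0.1) p.251 (bookkeeping)] -/
theorem exists_le_two_mul_pow (X : ℕ) : ∃ c₀ : ℕ, X ≤ 2 * P.L ^ c₀ :=
  ⟨X, le_trans (Nat.lt_two_pow_self).le (le_trans (Nat.pow_le_pow_left P.hL.2 X) (Nat.le_mul_of_pos_left _ two_pos))⟩

/-- ★ **THE COLLARED PRINT CUBE OF THE DATUM DOES NOT WRAP** — the S6 head's binder `Set.InjOn π (cube L (cornerP Mc ρ a) (sideP Mc ρ) ρ j 0)` (FILE 2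
`…N07SplitClauseRecordShearAtCubeDomains`, generation 6's `hinj`) from ONE torus-size inequality at the TOP level `k` of the token: `Mc + 11d + 6ρ ≤ sitesPerDir k`, `j ≤ k`
(k0-s1-w3's `injOn_cover_cube_propCubeP` at level `j`, the period antitone; `j ≤ m + K` follows from the same inequality).  The projections of `propCubeP` are `rfl`.
[cite: Balaban1985RegularSpaces, p.98 («□₀ ⊃ □₁ ⊃ … ⊃ □»); Balaban1985Variational, (144) p.300; Balaban1987RG1, (0.1) p.251] -/
theorem injOn_cover_cube_cornerP_of_le_sitesPerDir {j k : ℕ} (hj1 : 1 ≤ j) (hjk : j ≤ k) {Mc ρ : ℕ} (hρ : P.L ≤ ρ) (a : Pt P.d)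
    (hlev : Mc + 11 * P.d + 6 * ρ ≤ P.sitesPerDir k) :
    Set.InjOn (cover P) (cube P.L (cornerP P Mc ρ a) (sideP P Mc ρ) ρ j 0) := by
  have hw : Mc + 11 * P.d + 6 * ρ ≤ P.sitesPerDir j := hlev.trans (sitesPerDir_le_sitesPerDir_of_le hjk)
  have hjK : j ≤ P.m + P.K := le_m_add_K_of_three_le_sitesPerDir (le_trans (by have := P.hd; omega) hw)
  exact injOn_cover_cube_propCubeP (P := P) j hj1 hjK Mc ρ hρ a hw

/-- ★ **THE SAME FROM THE LEVEL GUARD** `k + c₀ ≤ m + K` with `Mc + 11d + 6ρ ≤ 2L^{c₀}`. [cite: Balaban1985RegularSpaces, p.98; Balaban1987RG1, (0.1) p.251] -/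
theorem injOn_cover_cube_cornerP_of_levelGuard {j k c₀ : ℕ} (hj1 : 1 ≤ j) (hjk : j ≤ k) (hlev : k + c₀ ≤ P.m + P.K) {Mc ρ : ℕ} (hρ : P.L ≤ ρ)
    (hc₀ : Mc + 11 * P.d + 6 * ρ ≤ 2 * P.L ^ c₀) (a : Pt P.d) :
    Set.InjOn (cover P) (cube P.L (cornerP P Mc ρ a) (sideP P Mc ρ) ρ j 0) :=
  injOn_cover_cube_cornerP_of_le_sitesPerDir hj1 hjk hρ a (hc₀.trans (two_mul_pow_le_sitesPerDir_of_levelGuard le_rfl hlev))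

end Arithmetic

/-! ## §2  The S3 door at NODE 00's four-tori, keyed on the floor ∕ the V20-G guard, in the head token's datum binders -/

section Door

variable {F : T4Family} {N : ℕ} [NeZero N]

/-- ★★★ **THE (152)∕(153) `Within`-WITNESS DOOR WITH THE KNIT's SIDE CONDITIONS DISCHARGED — FLOOR FORM** ([15] p. 300: *«Let us take a cube □ intersecting Ω_j but not
Ω_{j+1}»*; (144), (150)–(153) p. 301).  Binders in the order of `N07LocalLettersCoreGuarded.DatumGaugeSplitTopStepCoreG` at `Sup := suppDomOfRecord`: [6] Prop. 6 on print's
class at collar `ρ` — the HYPOTHESIS `hP6`; the grid-cube letter `1 ≤ Mc`; the prefix `ν M g K k s`, `L ≤ ρ`, separation; the FLOOR `(11·4 + 4ρ + Mc + 3)·L ≤ ν.M₁` and the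
TOP-LEVEL PERIOD BOUND `Mc + 11·4 + 6ρ ≤ sitesPerDir k`; radii `0 < ε_m ≤ a₀ ≤ a0OfP F N Mc ρ B₁ c₁`, `ε_m ≤ 2ε_{m+1}`; `U` in the (1.7)∕(1.9)-Top classes over
`suppDomOfRecord`; the DATUM `1 ≤ j ≤ k`, `a`, and the token's own witness `∃ x y, x ∈ cubeExt (side L Mc j) a 0 ∧ π y ∈ Ω_j(s) ∧ Within 3 x y`.  CONCLUSION = generation 6's:
ONE gauge `u`, ONE potential `A` — the gauge equation on the bonds of `regionOfSet (π '' box L (cornerP Mc ρ a) (sideP Mc ρ) j)`, `‖A‖, ‖∇A‖ < b9OfP F Mc ρ B₁ · ε_j` there,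
`‖∂*∂A‖, ‖ΔA‖ < …` on its deep bonds, and for every proof of `j ≤ m + K`, every `D′` with `ker Q′_{D′} ≤ ker Q′_{cubeDomains (cornerP Mc ρ a) (sideP Mc ρ) ρ j}` and every `φ`,
`RE D′ η_j⁻¹ (dsE η_j⁻¹ (Re ∕ Im(φ∘A))) = 0`.  Proof: `j ≤ m + K` and the non-wrapping from the period bound (§1), `M₀ := Mc` (`Or.inl rfl`), the ceiling via `a₀ ≤ a0OfP`,
then generation 6's `gauge152_REfiner153_box_of_within_of_prop6P_uniform` BY NAME at `Dw := 3`.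
[cite: Balaban1985Variational, (144) p.300, (150)–(153) p.301, p.304 lines 1–2; Balaban1985RegularSpaces, Prop. 6 (1.135)–(1.138) p.99, p.98; Balaban1984PropagatorsII, (2.10)–(2.12) p.225; Balaban1987RG1, (0.1) p.251] -/
theorem datumGauge152_REfiner153_of_prop6P_of_floor {B₁ c₁ : ℝ} (hB₁ : 0 ≤ B₁) (hc₁ : 0 < c₁) {ρ : ℕ}
    (hP6 : letI : CStarAlgebra (MatA N) := {}; B8.Prop6Printed 4 (F.L : ℝ) B₁ c₁ (fun i : ZdIdx 4 F.L => zdCubP (MatA N) F.L ρ i)) {Mc : ℕ} (hMc : 1 ≤ Mc)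
    (ν : Stage7Numerics) {M : ℕ} (g : ℕ → ℝ) (K k : ℕ) (hρ : (F.P K).L ≤ ρ) (s : SeqOfRecord F ν M g K k) (hsep : Sect2.SeqSeparated ν.M₁ s)
    (hfl : (11 * 4 + 4 * ρ + Mc + 3) * F.L ≤ ν.M₁) (hlev : Mc + 11 * 4 + 6 * ρ ≤ (F.P K).sitesPerDir k)
    (ε : ℕ → ℝ) {a₀ : ℝ} (ha₀ : a₀ ≤ a0OfP F N Mc ρ B₁ c₁)
    (hε : ∀ m, m ≤ k → 0 < ε m ∧ ε m ≤ a₀) (hcomp : ∀ m, m < k → ε m ≤ 2 * ε (m + 1))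
    (U : GaugeField (F.P K) 0 (SU N))
    (h17 : ∀ m, m ≤ k → PlaqSmallOn (Sect2.omegaPlaqsTop s.Ω (suppDomOfRecord F ν K s.Ω) m) (ε m * (F.P K).eta m ^ 2) U)
    (h19 : ∀ m, m ≤ k → Sect2.CoDivSmallOn (Sect2.omegaBondsTop s.Ω (suppDomOfRecord F ν K s.Ω) m) (ε m * (F.P K).eta m ^ 3) U)
    {j : ℕ} (hj1 : 1 ≤ j) (hjk : j ≤ k) (a : Pt (F.P K).d)
    (hdat : ∃ x y : Pt (F.P K).d, x ∈ cubeExt (side (F.P K).L Mc j) a 0 ∧ cover (F.P K) y ∈ s.Ω j ∧ Within ((3 : ℕ) : ℤ) x y) :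
    ∃ u : GaugeTransf (F.P K) 0 (SU N), ∃ A : PBond (F.P K) 0 → MatA N,
      (∀ b ∈ (Sect2.regionOfSet (F.P K) (cover (F.P K) '' box (F.P K).L (cornerP (F.P K) Mc ρ a) (sideP (F.P K) Mc ρ) j)).bonds,
          gaugeU (fun x => ιSU N (u x)) (fun b' => ιSU N (U b')) b = expI ((F.P K).eta j) (A b)) ∧
      (∀ b ∈ (Sect2.regionOfSet (F.P K) (cover (F.P K) '' box (F.P K).L (cornerP (F.P K) Mc ρ a) (sideP (F.P K) Mc ρ) j)).bonds,
          ‖A b‖ < b9OfP F Mc ρ B₁ * ε j) ∧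
      (∀ q ∈ (Sect2.regionOfSet (F.P K) (cover (F.P K) '' box (F.P K).L (cornerP (F.P K) Mc ρ a) (sideP (F.P K) Mc ρ) j)).dpairs,
          ‖grad ((F.P K).eta j) q.2.1 (fun y => A ⟨y, q.2.2⟩) q.1‖ < b9OfP F Mc ρ B₁ * ε j) ∧
      (∀ b ∈ Sect2.bondsDeep (cover (F.P K) '' box (F.P K).L (cornerP (F.P K) Mc ρ a) (sideP (F.P K) Mc ρ) j),
          ‖Sect2.codiffCurlA ((F.P K).eta j) A b.src b.dir‖ < b9OfP F Mc ρ B₁ * ε j) ∧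
      (∀ b ∈ Sect2.bondsDeep (cover (F.P K) '' box (F.P K).L (cornerP (F.P K) Mc ρ a) (sideP (F.P K) Mc ρ) j),
          ‖∑ ν' : Fin (F.P K).d, (((F.P K).eta j : ℝ) : ℂ)⁻¹ •
              (grad ((F.P K).eta j) ν' (fun y => A ⟨y, b.dir⟩) (b.src.unshift ν') - grad ((F.P K).eta j) ν' (fun y => A ⟨y, b.dir⟩) b.src)‖ <
            b9OfP F Mc ρ B₁ * ε j) ∧
      (∀ (hjK : j ≤ (F.P K).m + (F.P K).K) (D' : Domains (F.P K)),
        LinearMap.ker (QpE D') ≤ LinearMap.ker (QpE (cubeDomains (F.P K) (cornerP (F.P K) Mc ρ a) (sideP (F.P K) Mc ρ) ρ j hjK)) →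
        ∀ φ : MatA N →L[ℂ] ℂ,
          RE D' ((F.P K).eta j)⁻¹ (dsE ((F.P K).eta j)⁻¹ (WithLp.toLp 2 fun b => (φ (A b)).re : BondSpace (F.P K))) = 0 ∧
          RE D' ((F.P K).eta j)⁻¹ (dsE ((F.P K).eta j)⁻¹ (WithLp.toLp 2 fun b => (φ (A b)).im : BondSpace (F.P K))) = 0) := by
  letI : CStarAlgebra (MatA N) := {}
  -- the level range and the non-wrapping, from the top-level period bound (§1)
  have hlev' : Mc + 11 * (F.P K).d + 6 * ρ ≤ (F.P K).sitesPerDir k := by rw [T4Family.P_d]; exact hlev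
  have hjK : j ≤ (F.P K).m + (F.P K).K :=
    le_m_add_K_of_three_le_sitesPerDir (le_trans (by omega) (hlev.trans (sitesPerDir_le_sitesPerDir_of_le hjk)))
  have hinj : Set.InjOn (cover (F.P K)) (cube (F.P K).L (cornerP (F.P K) Mc ρ a) (sideP (F.P K) Mc ρ) ρ j 0) :=
    injOn_cover_cube_cornerP_of_le_sitesPerDir hj1 hjk hρ a hlev'
  -- the radii ceiling through `a₀ ≤ a0OfP`
  have hε' : ∀ m, m ≤ k → 0 < ε m ∧ ε m ≤ a0OfP F N Mc ρ B₁ c₁ := fun m hm => ⟨(hε m hm).1, (hε m hm).2.trans ha₀⟩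
  obtain ⟨x, y, hx, hy, hxy⟩ := hdat
  obtain ⟨u, A, h1, h2, h3, h4, h5, h6⟩ :=
    gauge152_REfiner153_box_of_within_of_prop6P_uniform hB₁ hc₁ hP6 hMc ν g K k hρ s hsep ε hε' hcomp U h17 h19 hj1 hjk hjK
      (Or.inl rfl) hfl a hx hy hxy hinj
  exact ⟨u, A, h1, h2, h3, h4, h5, fun _ D' hD' φ => h6 D' hD' φ⟩

/-- ★★★ **THE SAME KEYED ON THE PLAN's V20-G GUARD** `c ≤ ν.M₁ ∧ k + c₀ ≤ F.m + K` (dag-n07-e `K0-ROAD-CHAIN-CHECKLIST` § UPDATE g21; the S6 head's `Adm` instance), the two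
constants' side conditions stated ONCE: `(11·4 + 4ρ + Mc + 3)·L ≤ c` (print p. 304 lines 1–2 «R₁M₁ sufficiently big») and `Mc + 11·4 + 6ρ ≤ 2·L^{c₀}` ([I] (0.1): the windows of
an actual run do not wrap).  Inside the token the hypothesis `hadm` IS the guard's value at the prefix (β-reduced); everything else as in the floor form.
[cite: Balaban1985Variational, (144) p.300, (150)–(153) p.301, p.304 lines 1–2; Balaban1985RegularSpaces, Prop. 6 p.99, p.98, (1.3)–(1.6) p.77; Balaban1984PropagatorsII, (2.12) p.225; Balaban1987RG1, (0.1) p.251] -/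
theorem datumGauge152_REfiner153_of_prop6P_guarded {B₁ c₁ : ℝ} (hB₁ : 0 ≤ B₁) (hc₁ : 0 < c₁) {ρ : ℕ}
    (hP6 : letI : CStarAlgebra (MatA N) := {}; B8.Prop6Printed 4 (F.L : ℝ) B₁ c₁ (fun i : ZdIdx 4 F.L => zdCubP (MatA N) F.L ρ i)) {Mc : ℕ} (hMc : 1 ≤ Mc)
    {c c₀ : ℕ} (hc : (11 * 4 + 4 * ρ + Mc + 3) * F.L ≤ c) (hc₀ : Mc + 11 * 4 + 6 * ρ ≤ 2 * F.L ^ c₀)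
    (ν : Stage7Numerics) {M : ℕ} (g : ℕ → ℝ) (K k : ℕ) (hρ : (F.P K).L ≤ ρ) (s : SeqOfRecord F ν M g K k) (hsep : Sect2.SeqSeparated ν.M₁ s)
    (hadm : c ≤ ν.M₁ ∧ k + c₀ ≤ F.m + K)
    (ε : ℕ → ℝ) {a₀ : ℝ} (ha₀ : a₀ ≤ a0OfP F N Mc ρ B₁ c₁)
    (hε : ∀ m, m ≤ k → 0 < ε m ∧ ε m ≤ a₀) (hcomp : ∀ m, m < k → ε m ≤ 2 * ε (m + 1))
    (U : GaugeField (F.P K) 0 (SU N))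
    (h17 : ∀ m, m ≤ k → PlaqSmallOn (Sect2.omegaPlaqsTop s.Ω (suppDomOfRecord F ν K s.Ω) m) (ε m * (F.P K).eta m ^ 2) U)
    (h19 : ∀ m, m ≤ k → Sect2.CoDivSmallOn (Sect2.omegaBondsTop s.Ω (suppDomOfRecord F ν K s.Ω) m) (ε m * (F.P K).eta m ^ 3) U)
    {j : ℕ} (hj1 : 1 ≤ j) (hjk : j ≤ k) (a : Pt (F.P K).d)
    (hdat : ∃ x y : Pt (F.P K).d, x ∈ cubeExt (side (F.P K).L Mc j) a 0 ∧ cover (F.P K) y ∈ s.Ω j ∧ Within ((3 : ℕ) : ℤ) x y) :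
    ∃ u : GaugeTransf (F.P K) 0 (SU N), ∃ A : PBond (F.P K) 0 → MatA N,
      (∀ b ∈ (Sect2.regionOfSet (F.P K) (cover (F.P K) '' box (F.P K).L (cornerP (F.P K) Mc ρ a) (sideP (F.P K) Mc ρ) j)).bonds,
          gaugeU (fun x => ιSU N (u x)) (fun b' => ιSU N (U b')) b = expI ((F.P K).eta j) (A b)) ∧
      (∀ b ∈ (Sect2.regionOfSet (F.P K) (cover (F.P K) '' box (F.P K).L (cornerP (F.P K) Mc ρ a) (sideP (F.P K) Mc ρ) j)).bonds,
          ‖A b‖ < b9OfP F Mc ρ B₁ * ε j) ∧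
      (∀ q ∈ (Sect2.regionOfSet (F.P K) (cover (F.P K) '' box (F.P K).L (cornerP (F.P K) Mc ρ a) (sideP (F.P K) Mc ρ) j)).dpairs,
          ‖grad ((F.P K).eta j) q.2.1 (fun y => A ⟨y, q.2.2⟩) q.1‖ < b9OfP F Mc ρ B₁ * ε j) ∧
      (∀ b ∈ Sect2.bondsDeep (cover (F.P K) '' box (F.P K).L (cornerP (F.P K) Mc ρ a) (sideP (F.P K) Mc ρ) j),
          ‖Sect2.codiffCurlA ((F.P K).eta j) A b.src b.dir‖ < b9OfP F Mc ρ B₁ * ε j) ∧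
      (∀ b ∈ Sect2.bondsDeep (cover (F.P K) '' box (F.P K).L (cornerP (F.P K) Mc ρ a) (sideP (F.P K) Mc ρ) j),
          ‖∑ ν' : Fin (F.P K).d, (((F.P K).eta j : ℝ) : ℂ)⁻¹ •
              (grad ((F.P K).eta j) ν' (fun y => A ⟨y, b.dir⟩) (b.src.unshift ν') - grad ((F.P K).eta j) ν' (fun y => A ⟨y, b.dir⟩) b.src)‖ <
            b9OfP F Mc ρ B₁ * ε j) ∧
      (∀ (hjK : j ≤ (F.P K).m + (F.P K).K) (D' : Domains (F.P K)),
        LinearMap.ker (QpE D') ≤ LinearMap.ker (QpE (cubeDomains (F.P K) (cornerP (F.P K) Mc ρ a) (sideP (F.P K) Mc ρ) ρ j hjK)) →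
        ∀ φ : MatA N →L[ℂ] ℂ,
          RE D' ((F.P K).eta j)⁻¹ (dsE ((F.P K).eta j)⁻¹ (WithLp.toLp 2 fun b => (φ (A b)).re : BondSpace (F.P K))) = 0 ∧
          RE D' ((F.P K).eta j)⁻¹ (dsE ((F.P K).eta j)⁻¹ (WithLp.toLp 2 fun b => (φ (A b)).im : BondSpace (F.P K))) = 0) := by
  letI : CStarAlgebra (MatA N) := {}
  -- the floor half of the guard ⇒ the collar floor; the level half ⇒ the top-level period bound `Mc + 44 + 6ρ ≤ 2L^{c₀} ≤ sitesPerDir k`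
  have hfl : (11 * 4 + 4 * ρ + Mc + 3) * F.L ≤ ν.M₁ := hc.trans hadm.1
  have hlevP : k + c₀ ≤ (F.P K).m + (F.P K).K := by rw [T4Family.P_m, T4Family.P_K]; exact hadm.2
  have hlev : Mc + 11 * 4 + 6 * ρ ≤ (F.P K).sitesPerDir k := by
    refine hc₀.trans ?_
    have := two_mul_pow_le_sitesPerDir_of_levelGuard (P := F.P K) le_rfl hlevP
    rwa [T4Family.P_L] at this
  exact datumGauge152_REfiner153_of_prop6P_of_floor hB₁ hc₁ hP6 hMc ν g K k hρ s hsep hfl hlev ε ha₀ hε hcomp U h17 h19 hj1 hjk a hdat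

/-- ★ **THE GUARDED DOOR WITH [6] PROPOSITION 6 HELD AT A DIVISOR `ρ₀ ∣ ρ` OF THE COLLAR** (stub 2′ `stub_prop6MemberB8AtP13` supplies Prop. 6 on print's class at SOME
`ρ₀ ≥ 1`; the knit's collar `ρ` — chosen by `exists_halvingBudget` above a threshold and as a multiple of the big block and of `ρ₀` — inherits it by dag-n07-e's
`prop6Printed_zdCubP_anti`).  Constants `b9OfP F Mc ρ B₁`, `a0OfP F N Mc ρ B₁ c₁` at the knit's `ρ`.
[cite: Balaban1985RegularSpaces, Prop. 6 p.99, p.98 («M is a multiple of R₁M₁»); Balaban1985Variational, (144) p.300, (150)–(153) p.301; Balaban1987RG1, (0.1) p.251] -/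
theorem datumGauge152_REfiner153_of_prop6P_guarded_of_dvd {B₁ c₁ : ℝ} (hB₁ : 0 ≤ B₁) (hc₁ : 0 < c₁) {ρ₀ ρ : ℕ} (hdvd : ρ₀ ∣ ρ)
    (hP6 : letI : CStarAlgebra (MatA N) := {}; B8.Prop6Printed 4 (F.L : ℝ) B₁ c₁ (fun i : ZdIdx 4 F.L => zdCubP (MatA N) F.L ρ₀ i)) {Mc : ℕ} (hMc : 1 ≤ Mc)
    {c c₀ : ℕ} (hc : (11 * 4 + 4 * ρ + Mc + 3) * F.L ≤ c) (hc₀ : Mc + 11 * 4 + 6 * ρ ≤ 2 * F.L ^ c₀)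
    (ν : Stage7Numerics) {M : ℕ} (g : ℕ → ℝ) (K k : ℕ) (hρ : (F.P K).L ≤ ρ) (s : SeqOfRecord F ν M g K k) (hsep : Sect2.SeqSeparated ν.M₁ s)
    (hadm : c ≤ ν.M₁ ∧ k + c₀ ≤ F.m + K)
    (ε : ℕ → ℝ) {a₀ : ℝ} (ha₀ : a₀ ≤ a0OfP F N Mc ρ B₁ c₁)
    (hε : ∀ m, m ≤ k → 0 < ε m ∧ ε m ≤ a₀) (hcomp : ∀ m, m < k → ε m ≤ 2 * ε (m + 1))
    (U : GaugeField (F.P K) 0 (SU N))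
    (h17 : ∀ m, m ≤ k → PlaqSmallOn (Sect2.omegaPlaqsTop s.Ω (suppDomOfRecord F ν K s.Ω) m) (ε m * (F.P K).eta m ^ 2) U)
    (h19 : ∀ m, m ≤ k → Sect2.CoDivSmallOn (Sect2.omegaBondsTop s.Ω (suppDomOfRecord F ν K s.Ω) m) (ε m * (F.P K).eta m ^ 3) U)
    {j : ℕ} (hj1 : 1 ≤ j) (hjk : j ≤ k) (a : Pt (F.P K).d)
    (hdat : ∃ x y : Pt (F.P K).d, x ∈ cubeExt (side (F.P K).L Mc j) a 0 ∧ cover (F.P K) y ∈ s.Ω j ∧ Within ((3 : ℕ) : ℤ) x y) :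
    ∃ u : GaugeTransf (F.P K) 0 (SU N), ∃ A : PBond (F.P K) 0 → MatA N,
      (∀ b ∈ (Sect2.regionOfSet (F.P K) (cover (F.P K) '' box (F.P K).L (cornerP (F.P K) Mc ρ a) (sideP (F.P K) Mc ρ) j)).bonds,
          gaugeU (fun x => ιSU N (u x)) (fun b' => ιSU N (U b')) b = expI ((F.P K).eta j) (A b)) ∧
      (∀ b ∈ (Sect2.regionOfSet (F.P K) (cover (F.P K) '' box (F.P K).L (cornerP (F.P K) Mc ρ a) (sideP (F.P K) Mc ρ) j)).bonds,
          ‖A b‖ < b9OfP F Mc ρ B₁ * ε j) ∧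
      (∀ q ∈ (Sect2.regionOfSet (F.P K) (cover (F.P K) '' box (F.P K).L (cornerP (F.P K) Mc ρ a) (sideP (F.P K) Mc ρ) j)).dpairs,
          ‖grad ((F.P K).eta j) q.2.1 (fun y => A ⟨y, q.2.2⟩) q.1‖ < b9OfP F Mc ρ B₁ * ε j) ∧
      (∀ b ∈ Sect2.bondsDeep (cover (F.P K) '' box (F.P K).L (cornerP (F.P K) Mc ρ a) (sideP (F.P K) Mc ρ) j),
          ‖Sect2.codiffCurlA ((F.P K).eta j) A b.src b.dir‖ < b9OfP F Mc ρ B₁ * ε j) ∧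
      (∀ b ∈ Sect2.bondsDeep (cover (F.P K) '' box (F.P K).L (cornerP (F.P K) Mc ρ a) (sideP (F.P K) Mc ρ) j),
          ‖∑ ν' : Fin (F.P K).d, (((F.P K).eta j : ℝ) : ℂ)⁻¹ •
              (grad ((F.P K).eta j) ν' (fun y => A ⟨y, b.dir⟩) (b.src.unshift ν') - grad ((F.P K).eta j) ν' (fun y => A ⟨y, b.dir⟩) b.src)‖ <
            b9OfP F Mc ρ B₁ * ε j) ∧
      (∀ (hjK : j ≤ (F.P K).m + (F.P K).K) (D' : Domains (F.P K)),
        LinearMap.ker (QpE D') ≤ LinearMap.ker (QpE (cubeDomains (F.P K) (cornerP (F.P K) Mc ρ a) (sideP (F.P K) Mc ρ) ρ j hjK)) →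
        ∀ φ : MatA N →L[ℂ] ℂ,
          RE D' ((F.P K).eta j)⁻¹ (dsE ((F.P K).eta j)⁻¹ (WithLp.toLp 2 fun b => (φ (A b)).re : BondSpace (F.P K))) = 0 ∧
          RE D' ((F.P K).eta j)⁻¹ (dsE ((F.P K).eta j)⁻¹ (WithLp.toLp 2 fun b => (φ (A b)).im : BondSpace (F.P K))) = 0) := by
  letI : CStarAlgebra (MatA N) := {}
  exact datumGauge152_REfiner153_of_prop6P_guarded hB₁ hc₁ (prop6Printed_zdCubP_anti (fun i : ZdIdx 4 F.L => i) hdvd hP6) hMc hc hc₀ ν g K k hρ s hsep hadm ε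
    ha₀ hε hcomp U h17 h19 hj1 hjk a hdat

end Door

/-! ## §3  The MEET face of clause 6 — the boundary-datum family `cubeDomains ⊓ D♭` ([15] (150) «Ω′_j = □_j ∩ Ω_j») -/

section Meet

variable {P : Params}

/-- ★ **A ROW QUANTIFIED OVER ALL KERNEL-FINER FAMILIES HOLDS AT EVERY MEET WITH THE CUBE FAMILY (left factor)**: clause 6 of the door is stated for every `D′` with
`ker Q′_{D′} ≤ ker Q′_{D_□}`; the meet `D_□ ⊓ D♭` is below `D_□` (dag-n07-e `domainsMeet_le_left`), hence kernel-finer (`ker_QpE_le_of_domainsLe`) — so the (153) rows hold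
at the boundary-datum family of the S6 recipe for the SAME potential.  Generic `P`, any two scalar fields (the door feeds `dsE η⁻¹ (Re ∕ Im(φ∘A))`). [cite: Balaban1985Variational, (150) p.301, (153) p.301; Balaban1984PropagatorsII, (2.10)–(2.12) p.225] -/
theorem RE_zero_meet_left_of_finer {Dc : Domains P} {c : ℝ} {v w : ScalarSpace P}
    (h6 : ∀ D' : Domains P, LinearMap.ker (QpE D') ≤ LinearMap.ker (QpE Dc) → RE D' c v = 0 ∧ RE D' c w = 0) (D₂ : Domains P) :
    RE (domainsMeet Dc D₂) c v = 0 ∧ RE (domainsMeet Dc D₂) c w = 0 :=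
  h6 _ (ker_QpE_le_of_domainsLe (domainsMeet_le_left Dc D₂))

/-- ★ The same with the cube family as the RIGHT factor of the meet (`D♭ ⊓ D_□`). [cite: Balaban1985Variational, (150) p.301; Balaban1984PropagatorsII, (2.10)–(2.12) p.225] -/
theorem RE_zero_meet_right_of_finer {Dc : Domains P} {c : ℝ} {v w : ScalarSpace P}
    (h6 : ∀ D' : Domains P, LinearMap.ker (QpE D') ≤ LinearMap.ker (QpE Dc) → RE D' c v = 0 ∧ RE D' c w = 0) (D₁ : Domains P) :
    RE (domainsMeet D₁ Dc) c v = 0 ∧ RE (domainsMeet D₁ Dc) c w = 0 :=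
  h6 _ (ker_QpE_le_of_domainsLe (domainsMeet_le_right D₁ Dc))

end Meet

/-! ## §4  The S6 head's numerics ∕ geometry binders at the S3 datum, from the level guard (k0-s1-w3's `numerics_propCubeP`, re-keyed) -/

section Numerics

/-- ★ **THE HEAD's FILE 2 NUMERICS BINDERS AT THE DATUM `(cornerP Mc ρ a, sideP Mc ρ, ρ, j)` FROM THE LEVEL GUARD**: with the big block `F.L·M_h`, `M_h = L^{a′}`,
`a′ + 1 ≤ c₀`, a collar `ρ ≥ L` with `F.L·M_h ∣ ρ`, the level guard `k + c₀ ≤ F.m + K`, `1 ≤ j ≤ k`, and `Mc + 44 + 6ρ ≤ 2L^{c₀}`: the corner lies on the `F.L·M_h`-grid,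
`F.L·M_h ∣ sideP Mc ρ`, `F.L·M_h ∣ sitesPerDir j`, and the collared print cube does not wrap — the four geometry binders of
`N07SplitClauseRecordShearAtCubeDomains.localGaugeSplitOn_of_gauge152_recordShear_dominated_cubeDomains_box` at the S3 datum (k0-s1-w3's `isPrint_propCubeP … .of_dvd`,
`pow_dvd_sitesPerDir_of_le`, §1 — BY NAME; the projections of `propCubeP` are `rfl`). [cite: Balaban1985RegularSpaces, p.98 («M is a multiple of R₁M₁», «□_j is a sum of the big blocks»); Balaban1984PropagatorsII, (2.1) p.224; Balaban1987RG1, (0.1) p.251] -/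
theorem numerics_cornerP_of_levelGuard (F : T4Family) {K k j c₀ : ℕ} (hj1 : 1 ≤ j) (hjk : j ≤ k) (hlev : k + c₀ ≤ F.m + K)
    {Mh a' : ℕ} (hMh : Mh = F.L ^ a') (ha' : a' + 1 ≤ c₀) {Mc ρ : ℕ} (hρ : (F.P K).L ≤ ρ) (hdvd : F.L * Mh ∣ ρ)
    (hc₀ : Mc + 11 * 4 + 6 * ρ ≤ 2 * F.L ^ c₀) (a : Pt (F.P K).d) :
    (∀ i, ((F.L * Mh : ℕ) : ℤ) ∣ cornerP (F.P K) Mc ρ a i) ∧ F.L * Mh ∣ sideP (F.P K) Mc ρ ∧ F.L * Mh ∣ (F.P K).sitesPerDir j ∧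
    Set.InjOn (cover (F.P K)) (cube (F.P K).L (cornerP (F.P K) Mc ρ a) (sideP (F.P K) Mc ρ) ρ j 0) := by
  have hP := (isPrint_propCubeP (F.P K) j hj1 Mc ρ hρ a).of_dvd hdvd
  have hlevP : k + c₀ ≤ (F.P K).m + (F.P K).K := by rw [T4Family.P_m, T4Family.P_K]; exact hlev
  have hc₀P : Mc + 11 * (F.P K).d + 6 * ρ ≤ 2 * (F.P K).L ^ c₀ := by rw [T4Family.P_d, T4Family.P_L]; exact hc₀
  refine ⟨hP.corner_dvd, hP.side_dvd, ?_, injOn_cover_cube_cornerP_of_levelGuard hj1 hjk hlevP hρ hc₀P a⟩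
  rw [hMh, ← pow_succ']
  refine Summit.QuantumFields.YangMills.Theorems.K0S5CollarNumerics.pow_dvd_sitesPerDir_of_le (P := F.P K) ?_
  rw [T4Family.P_m, T4Family.P_K]
  omega

end Numerics

end Summit.QuantumFields.YangMills.BalabanUVNodes.N07DatumGauge152Guarded

end
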